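import Mathlib
import Literature.Barriers.Parity.FordMaynardPrimeSieves

/-!
# Route `FordMaynardSieveConst01651`, target `SieveConst01651` (stmt-Parity-19185), line `sieve_decomposition`:
# helpers towards `stub_typeIIRegion` — (I) controls `|w|` on any set with distinct divisor representatives

The Type-I bound (I) takes, for EVERY modulus `m ≤ x^γ`, the worst interval.  Choosing for each `n` of a set `S` a
divisor `m(n) ≤ x^γ` with `n ↦ m(n)` injective on `S`, and for the modulus `m(n)` the one-point interval `{n/m(n)}`,
shows `∑_{n ∈ S} |w(n)| ≤ x/(log x)^B` — with NO sign hypothesis on `w`.  This is how sparse but STRUCTURED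
exceptional sets are discarded: prime powers `p^k` in the window (`m(p^k) = p^{⌊k/2⌋}`), the `n = P⁻(n)^{1/ν}`
boundary case of the smooth/rough split (where `H(n) = 1`), products `n = d²` on the boundary `d = √n`, … .

* `typeI_abs_sum_le_of_injOn` — the statement above.
* `typeI_abs_le` — the case `S = {n}`, `m = 1`: `|w(n)| ≤ x/(log x)^B` pointwise on the window.

Def-free. Nothing here proves anything about the Parity summit; helpers for the Type-II region stub of one leaf.
-/

open Finset

namespace Summit.Parity.GeneralizedHardyLittlewood.FordMaynardSieveConst01651SieveConst01651

/-- **(I) bounds `∑_{n ∈ S} |w(n)|` whenever `S` admits distinct divisor representatives `m(n) ∣ n`,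
`1 ≤ m(n) ≤ x^γ` (injective on `S`), `S` inside the window `(x/2, x]`** — by testing (I) with the one-point
intervals `I(m(n)) = {n / m(n)}`. [cite: FordMaynard2024PrimeSieves, §1 (I)] -/
theorem typeI_abs_sum_le_of_injOn {w : ℕ → ℝ} {x γ B : ℝ}
    (hI : Literature.Barriers.Parity.FordMaynard.TypeI w x γ B) (hB : 0 ≤ B) (S : Finset ℕ) (m : ℕ → ℕ)
    (hwin : ∀ n ∈ S, x / 2 < (n : ℝ) ∧ (n : ℝ) ≤ x)
    (hm : ∀ n ∈ S, m n ∣ n ∧ 1 ≤ m n ∧ m n ≤ ⌊x ^ γ⌋₊) (hinj : Set.InjOn m S) :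
    ∑ n ∈ S, |w n| ≤ x / Real.log x ^ B := by
  classical
  -- one-point intervals at the represented moduli
  set I : ℕ → ℕ × ℕ := fun d =>
    if h : ∃ n ∈ S, m n = d then ((Classical.choose h) / d, (Classical.choose h) / d) else (1, 0) with hIdef
  have key := hI I
  -- the summand of (I) at modulus `d`
  set Φ : ℕ → ℝ := fun d => ((d.divisors.card : ℝ) ^ B) *
    |∑ f ∈ (Icc (I d).1 (I d).2).filter (fun f : ℕ => x / 2 < (d * f : ℝ) ∧ (d * f : ℝ) ≤ x), w (d * f)|
    with hΦ
  have hΦ0 : ∀ d, 0 ≤ Φ d := fun d =>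
    mul_nonneg (Real.rpow_nonneg (Nat.cast_nonneg _) _) (abs_nonneg _)
  -- at `d = m n` the inner sum is `w n`
  have hpoint : ∀ n ∈ S, |w n| ≤ Φ (m n) := by
    intro n hn
    obtain ⟨hdvd, h1, _⟩ := hm n hn
    have hex : ∃ n' ∈ S, m n' = m n := ⟨n, hn, rfl⟩
    have hchoose : Classical.choose hex = n := by
      obtain ⟨hmem, heq⟩ := Classical.choose_spec hex
      exact hinj hmem hn heq
    have hI' : I (m n) = (n / m n, n / m n) := by
      simp only [hIdef, dif_pos hex, hchoose]
    have hmul : m n * (n / m n) = n := Nat.mul_div_cancel' hdvd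
    have hinner : ∑ f ∈ (Icc (I (m n)).1 (I (m n)).2).filter
        (fun f : ℕ => x / 2 < (m n * f : ℝ) ∧ (m n * f : ℝ) ≤ x), w (m n * f) = w n := by
      rw [hI', Finset.Icc_self, Finset.sum_filter, Finset.sum_singleton]
      have hcast : ((m n : ℝ) * ((n / m n : ℕ) : ℝ)) = (n : ℝ) := by exact_mod_cast hmul
      rw [hcast, if_pos (hwin n hn), hmul]
    have hτ : (1 : ℝ) ≤ ((m n).divisors.card : ℝ) ^ B := by
      refine Real.one_le_rpow ?_ hB
      exact_mod_cast Finset.card_pos.mpr ⟨1, Nat.one_mem_divisors.mpr (by omega)⟩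
    simp only [hΦ]
    rw [hinner]
    calc |w n| = 1 * |w n| := (one_mul _).symm
      _ ≤ ((m n).divisors.card : ℝ) ^ B * |w n| := mul_le_mul_of_nonneg_right hτ (abs_nonneg _)
  -- sum over `S`, re-index by `m`, enlarge to all moduli
  have himage : S.image m ⊆ Icc 1 ⌊x ^ γ⌋₊ := by
    intro d hd
    obtain ⟨n, hn, rfl⟩ := Finset.mem_image.mp hd
    exact Finset.mem_Icc.mpr ⟨(hm n hn).2.1, (hm n hn).2.2⟩
  calc ∑ n ∈ S, |w n| ≤ ∑ n ∈ S, Φ (m n) := Finset.sum_le_sum hpoint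
    _ = ∑ d ∈ S.image m, Φ d := (Finset.sum_image hinj).symm
    _ ≤ ∑ d ∈ Icc 1 ⌊x ^ γ⌋₊, Φ d :=
        Finset.sum_le_sum_of_subset_of_nonneg himage fun d _ _ => hΦ0 d
    _ ≤ x / Real.log x ^ B := key

/-- **Pointwise**: `|w(n)| ≤ x/(log x)^B` for every `n` in the window, whenever (I) holds with `B ≥ 0` and
`x^γ ≥ 1` (modulus `1`, interval `{n}`). [cite: FordMaynard2024PrimeSieves, §1 (I)] -/
theorem typeI_abs_le {w : ℕ → ℝ} {x γ B : ℝ}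
    (hI : Literature.Barriers.Parity.FordMaynard.TypeI w x γ B) (hB : 0 ≤ B) (hx : 1 ≤ ⌊x ^ γ⌋₊)
    {n : ℕ} (hwin : x / 2 < (n : ℝ) ∧ (n : ℝ) ≤ x) :
    |w n| ≤ x / Real.log x ^ B := by
  have h := typeI_abs_sum_le_of_injOn hI hB {n} (fun _ => 1) (fun n' hn' => by
    rw [Finset.mem_singleton] at hn'; subst hn'; exact hwin)
    (fun n' _ => ⟨one_dvd _, le_rfl, hx⟩) (fun a ha b hb _ => by
      rw [Finset.coe_singleton, Set.mem_singleton_iff] at ha hb; rw [ha, hb])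
  simpa using h

end Summit.Parity.GeneralizedHardyLittlewood.FordMaynardSieveConst01651SieveConst01651
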